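import Summits.CriticalPhenomena.CardyFormulaZ2.Theorems.CardyMagicRigidityNestingRigidityNeckZ2NodeReimerSpatial
import HarnessLib

/-!
# Crux `NestingRigidity`, line `pinch-resampling` (v4), stub S12: Reimer glue inside a REGION, arms separated by cluster OR by space

Crux `Summit.CriticalPhenomena.CardyFormulaZ2.Theses.CardyMagicRigidity.NestingRigidity`
(stmt-CriticalPhenomena-4835), line `pinch-resampling` v4, stub S12 `stub_neckHookupCoarseZ2 : NeckHookupCoarseZ2`.
Sequel of `…NeckZ2NodeReimerSpatial` (`real_fourArm_and_arms_le`, worker W1 of wave 5), for the summation of the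
necklace bound `ZNodeAbsBoundChainA` (`…NeckZ2ErrorCoverChain`; worker W6a).  Two corrections of the glued bound
dictated by the necklace event `ZNodeEventChainA`:

1. **Clusters inside a region.**  The necklace clusters are distinct as open clusters of the big ball `Λ_{2s}(x)`
   (`¬ PathIn (openGraph ω) (zBall x (2 * s)) …`), not of the whole plane — the two end clusters both reach the outer
   layer and may well be joined outside the ball.  So the distinctness of the arm clusters, their avoidance of the
   crossing clusters of the nodes, and the far point of each arm are all taken INSIDE a region `S` (here any set
   containing the node annuli); the witnesses are then edge-disjoint because every witness vertex is joined to its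
   arm's start inside `S`.
2. **Arms separated by cluster or by space.**  Two arms may belong to the same cluster provided their annuli are
   disjoint (a necklace cluster crosses several node annuli of the hierarchy and lends an arm in each): for every
   pair of arms EITHER the starts are not joined inside `S` OR the annuli are disjoint.

* §1 `NeckCoarseZ2.mem_fourArm_disjointOccurrence_armsIn` — the deterministic core (as
  `mem_fourArm_disjointOccurrence_arms'`, relativised to `S`, with the weaker pairwise arm hypothesis).
* §2 `real_fourArm_and_armsIn_le` (registered anchor) — the glued bound
  `P ≤ (∏ c (r a / R a)^{1+ε}) · ∏ C (r' i / (R' i - 1))^α`, by `reimer_local_finitary_list` exactly as before.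
-/

noncomputable section

namespace Summit.CriticalPhenomena.CardyFormulaZ2.Cruxes.NestingRigidity.PinchResampling

open MeasureTheory Set Literature.Probability.Percolation Literature.Probability.LatticeModels
open ZPinchLocality

namespace NeckCoarseZ2

variable {ω : BondConfig (Site 2)}

/-! ## §1 The deterministic core inside a region -/

/-- **Disjoint occurrence of the four-arm events and the arm events, inside a region** (deterministic core of
`real_fourArm_and_armsIn_le`): on a lattice configuration, crossings of the node annuli (all contained in `S`) as in
the four-arm events, and arms started at `c i` and reaching sup distance `≥ R' i` from `w' i` INSIDE `S`, such that
(i) two distinct arms have starts not joined inside `S` or disjoint annuli, and (ii) each arm either has its start joined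
inside `S` to neither crossing start of a node or has its annulus disjoint from the node's annulus, give
`ω ∈ (⋂ four-arm events) □ (arm event □ arm event □ ⋯)`. -/
theorem mem_fourArm_disjointOccurrence_armsIn (hHG : ∀ a b, (openGraph ω).Adj a b → (zdGraph 2).Adj a b)
    (S : Set (Site 2)) {ι κ : Type*} (t : Finset ι) (w : ι → Site 2) (r R : ι → ℕ)
    (hrR : ∀ a ∈ t, 1 ≤ r a ∧ r a ≤ R a) (hS : ∀ a ∈ t, zAnn (w a) (r a) (R a) ⊆ S)
    (l : List κ) (hl : l.Nodup) (w' : κ → Site 2) (r' R' : κ → ℕ) (hrR' : ∀ i ∈ l, r' i ≤ R' i)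
    (p₁ q₁ p₂ q₂ : ι → Site 2) (c : κ → Site 2)
    (h4a : ∀ a ∈ t, zNorm (p₁ a - w a) = r a ∧ zNorm (q₁ a - w a) = R a ∧ zNorm (p₂ a - w a) = r a ∧
      zNorm (q₂ a - w a) = R a ∧ PathIn (openGraph ω) (zAnn (w a) (r a) (R a)) (p₁ a) (q₁ a) ∧
      PathIn (openGraph ω) (zAnn (w a) (r a) (R a)) (p₂ a) (q₂ a) ∧
      ¬ PathIn (openGraph ω) (zAnn (w a) (r a) (R a)) (p₁ a) (p₂ a))
    (harm : ∀ i ∈ l, zNorm (c i - w' i) < r' i ∧ ∃ q, (R' i : ℤ) ≤ zNorm (q - w' i) ∧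
      PathIn (openGraph ω) S (c i) q)
    (hdist : ∀ i ∈ l, ∀ j ∈ l, i ≠ j → ¬ PathIn (openGraph ω) S (c i) (c j) ∨
      Disjoint (zAnn (w' i) (r' i) (R' i)) (zAnn (w' j) (r' j) (R' j)))
    (havoid : ∀ i ∈ l, ∀ a ∈ t, (¬ PathIn (openGraph ω) S (c i) (p₁ a) ∧ ¬ PathIn (openGraph ω) S (c i) (p₂ a)) ∨
      Disjoint (zAnn (w' i) (r' i) (R' i)) (zAnn (w a) (r a) (R a))) :
    ω ∈ (⋂ a ∈ t, fourArmTwoClustersAt (w a) (r a) (R a)) □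
      disjointOccurrenceList (l.map fun i ↦ zOneArmAt (w' i) (r' i) (R' i)) := by
  classical
  -- finite witnesses of the crossings
  have hw₁ : ∀ a ∈ t, ∃ W : Finset (Sym2 (Site 2)), ↑W ⊆ ω ∧
      PathIn (openGraph ↑W) (zAnn (w a) (r a) (R a)) (p₁ a) (q₁ a) ∧
      ∀ e ∈ W, ∀ z ∈ e, PathIn (openGraph ω) (zAnn (w a) (r a) (R a)) (p₁ a) z :=
    fun a ha ↦ exists_finset_witness_of_pathIn (h4a a ha).2.2.2.2.1
  have hw₂ : ∀ a ∈ t, ∃ W : Finset (Sym2 (Site 2)), ↑W ⊆ ω ∧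
      PathIn (openGraph ↑W) (zAnn (w a) (r a) (R a)) (p₂ a) (q₂ a) ∧
      ∀ e ∈ W, ∀ z ∈ e, PathIn (openGraph ω) (zAnn (w a) (r a) (R a)) (p₂ a) z :=
    fun a ha ↦ exists_finset_witness_of_pathIn (h4a a ha).2.2.2.2.2.1
  choose! W₁ hW₁ω hW₁p hW₁c using hw₁
  choose! W₂ hW₂ω hW₂p hW₂c using hw₂
  -- finite witnesses of the arms, joined to the `c i` inside `S` and carried by the arm annuli
  have key : ∀ i ∈ l, ∃ K : Finset (Sym2 (Site 2)), ↑K ⊆ ω ∧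
      (↑K : Set (Sym2 (Site 2))) ∈ zOneArmAt (w' i) (r' i) (R' i) ∧
      ∀ e ∈ K, ∀ z ∈ e, PathIn (openGraph ω) S (c i) z ∧ z ∈ zAnn (w' i) (r' i) (R' i) := by
    intro i hi
    obtain ⟨hnear, q, hqR, hpath⟩ := harm i hi
    obtain ⟨p, q', hp, hq', hcross, hcp⟩ := exists_zAnn_crossing_of_pathIn hHG (hrR' i hi) hnear hqR hpath
    obtain ⟨K, hKω, hK, hKu⟩ := exists_finset_witness_of_pathIn hcross
    exact ⟨K, hKω, ⟨p, q', hp, hq', hK.mono inter_subset_right⟩, fun e he z hz ↦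
      ⟨hcp.trans ((hKu e he z hz).mono inter_subset_left), ((hKu e he z hz).right_mem).2⟩⟩
  choose! K hKω hKA hKc using key
  -- the cylinder of the four-arm events
  have hcyl : localCylinder (⋃ a ∈ t, (↑(W₁ a) ∪ ↑(W₂ a) ∪ ((zAnn (w a) (r a) (R a)).sym2 \ ω))) ω ⊆
      ⋂ a ∈ t, fourArmTwoClustersAt (w a) (r a) (R a) := by
    intro ω' hω'
    refine mem_iInter₂.2 fun a ha ↦ ?_
    obtain ⟨hp₁, hq₁, hp₂, hq₂, -, -, hn⟩ := h4a a ha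
    exact localCylinder_subset_fourArm (hrR a ha).1 (hrR a ha).2 hp₁ hq₁ hp₂ hq₂ (hW₁ω a ha) (hW₂ω a ha)
      (hW₁p a ha) (hW₂p a ha) hn
      (fun e he ↦ hω' e (mem_biUnion ha he))
  have hmem := mem_inter_disjointOccurrenceList_of_witnesses hcyl
    (l.map fun i ↦ (zOneArmAt (w' i) (r' i) (R' i), (↑(K i) : Set (Sym2 (Site 2)))))
    (fun q hq ↦ by
      obtain ⟨i, -, rfl⟩ := List.mem_map.1 hq
      exact isUpperSet_zOneArmAt _ _ _)
    (fun q hq ↦ by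
      obtain ⟨i, hi, rfl⟩ := List.mem_map.1 hq
      exact hKA i hi)
    (fun q hq ↦ by
      obtain ⟨i, hi, rfl⟩ := List.mem_map.1 hq
      exact hKω i hi)
    ?_ ?_
  · rw [List.map_map] at hmem
    exact hmem
  · -- two arms have edge-disjoint witnesses: separated by cluster (inside `S`) or by space
    rw [List.pairwise_map]
    refine hl.pairwise_of_forall_ne fun i hi j hj hij ↦ ?_
    rw [Finset.disjoint_coe, Finset.disjoint_left]
    intro e hei hej
    obtain ⟨z, hz⟩ : ∃ z, z ∈ e := ⟨e.out.1, Sym2.out_fst_mem e⟩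
    rcases hdist i hi j hj hij with hcl | hsp
    · exact hcl ((hKc i hi e hei z hz).1.trans (hKc j hj e hej z hz).1.symm)
    · exact Set.disjoint_left.1 hsp (hKc i hi e hei z hz).2 (hKc j hj e hej z hz).2
  · -- arm witnesses avoid the cylinder: they are open (not closed), and in other clusters than the crossings
    intro q hq
    obtain ⟨i, hi, rfl⟩ := List.mem_map.1 hq
    rw [Set.disjoint_iUnion₂_left]
    intro a ha
    rw [Set.disjoint_left]
    rcases havoid i hi a ha with hcl | hsp
    · -- separated by cluster, inside `S ⊇ zAnn (w a) (r a) (R a)`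
      rintro e (⟨he | he⟩ | he) heK
      · obtain ⟨z, hz⟩ : ∃ z, z ∈ e := ⟨e.out.1, Sym2.out_fst_mem e⟩
        exact hcl.1 ((hKc i hi e heK z hz).1.trans (((hW₁c a ha e he z hz).mono (hS a ha)).symm))
      · obtain ⟨z, hz⟩ : ∃ z, z ∈ e := ⟨e.out.1, Sym2.out_fst_mem e⟩
        exact hcl.2 ((hKc i hi e heK z hz).1.trans (((hW₂c a ha e he z hz).mono (hS a ha)).symm))
      · exact he.2 (hKω i hi heK)
    · -- separated by space: the cylinder part lies over the node annulus, the arm witness over the arm annulus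
      intro e he heK
      have heK' : e ∈ (zAnn (w' i) (r' i) (R' i)).sym2 :=
        Set.mem_sym2_iff_subset.2 fun z hz ↦ (hKc i hi e heK z hz).2
      have he' : e ∈ (zAnn (w a) (r a) (R a)).sym2 := by
        rcases he with (he | he) | he
        · exact Set.mem_sym2_iff_subset.2 fun z hz ↦ (hW₁c a ha e he z hz).right_mem
        · exact Set.mem_sym2_iff_subset.2 fun z hz ↦ (hW₂c a ha e he z hz).right_mem
        · exact he.1
      exact Set.disjoint_left.1 (disjoint_sym2_of_disjoint hsp) heK' he'

end NeckCoarseZ2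

/-! ## §2 The glued bound inside a region -/

/-- **Four-arm node events over disjoint annuli AND arms, inside a region, the arms separated pairwise by cluster or
by space (registered helper, anchor of this module on the crux item).**  There are `c, ε, C, α > 0` (the constants of
`real_biInter_fourArmTwoClustersAt_le_prod_rpow` and `NeckCoarseZ2.real_zOneArmAt_le`) such that for every region `S`,
all finite families of pairwise disjoint annuli `zAnn (w a) (r a) (R a) ⊆ S` (`1 ≤ r a ≤ R a`) and of arm data
`(w' i, r' i, R' i)` (`1 ≤ r' i < R' i`), the probability under `P_{1/2}` on `ℤ²` that every annulus carries two open
crossings not joined by an open path of the annulus, and points `c i` with `|c i - w' i|_∞ < r' i` are joined INSIDE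
`S` by open paths to sup distance `≥ R' i` from `w' i`, where for `i ≠ j` the starts `c i, c j` are not joined inside
`S` OR the two arm annuli are disjoint, and for each arm `i` and node `a` the start `c i` is joined inside `S` to
neither crossing start OR the arm annulus is disjoint from the node annulus, is at most
`(∏ c (r a / R a)^{1+ε}) · ∏ C (r' i / (R' i - 1))^α`. -/
theorem real_fourArm_and_armsIn_le : ∃ c ε C α : ℝ, 0 < c ∧ 0 < ε ∧ 0 < C ∧ 0 < α ∧ ∀ (S : Set (Site 2)) (ι κ : Type) (t : Finset ι) (w : ι → Site 2) (r R : ι → ℕ) (u : Finset κ) (w' : κ → Site 2) (r' R' : κ → ℕ), (∀ a ∈ t, 1 ≤ r a ∧ r a ≤ R a) → (∀ a ∈ t, NeckCoarseZ2.zAnn (w a) (r a) (R a) ⊆ S) → (↑t : Set ι).PairwiseDisjoint (fun a ↦ NeckCoarseZ2.zAnn (w a) (r a) (R a)) → (∀ i ∈ u, 1 ≤ r' i ∧ r' i + 1 ≤ R' i) → (bondPercolation (zdGraph 2) half).real {ω | ∃ (p₁ q₁ p₂ q₂ : ι → Site 2) (c : κ → Site 2), (∀ a ∈ t, zNorm (p₁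 a - w a) = r a ∧ zNorm (q₁ a - w a) = R a ∧ zNorm (p₂ a - w a) = r a ∧ zNorm (q₂ a - w a) = R a ∧ PathIn (openGraph ω) (NeckCoarseZ2.zAnn (w a) (r a) (R a)) (p₁ a) (q₁ a) ∧ PathIn (openGraph ω) (NeckCoarseZ2.zAnn (w a) (r a) (R a)) (p₂ a) (q₂ a) ∧ ¬ PathIn (openGraph ω) (NeckCoarseZ2.zAnn (w a) (r a) (R a)) (p₁ a) (p₂ a)) ∧ (∀ i ∈ u, zNorm (c i - w' i) < r' i ∧ ∃ q, (R' i : ℤ) ≤ zNorm (q - w' i) ∧ PathIn (openGraph ω) S (c i) q) ∧ (∀ i ∈ u, ∀ j ∈ u, i ≠ j → ¬ PathIn (openGraph ω) S (c i) (c j) ∨ Disjoint (NeckCoarseZ2.zAnn (w' i) (r' i) (R' i)) (NeckCoarseZ2.zAnn (w' j) (r' j) (R' j))) ∧ (∀ i ∈ u, ∀ a ∈ t, (¬ PathIn (openGraph ω) S (c i) (p₁ a) ∧ ¬ PathIn (openGraph ω) S (c i) (p₂ a)) ∨ Disjoint (NeckCoarseZ2.zAnn (w' i) (r' i) (R' i))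 (NeckCoarseZ2.zAnn (w a) (r a) (R a)))} ≤ (∏ a ∈ t, c * ((r a : ℝ) / R a) ^ (1 + ε)) * ∏ i ∈ u, C * ((r' i : ℝ) / ((R' i - 1 : ℕ) : ℝ)) ^ α := by
  obtain ⟨c, ε, hc, hε, h4⟩ := real_biInter_fourArmTwoClustersAt_le_prod_rpow
  obtain ⟨C, α, hC, hα, h1⟩ := NeckCoarseZ2.real_zOneArmAt_le
  refine ⟨c, ε, C, α, hc, hε, hC, hα, fun S ι κ t w r R u w' r' R' hrR hS hdisj hrR' ↦ ?_⟩
  classical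
  obtain ⟨E, hE⟩ : ∃ E : Set (BondConfig (Site 2)), E = {ω | ∃ (p₁ q₁ p₂ q₂ : ι → Site 2) (c : κ → Site 2),
      (∀ a ∈ t, zNorm (p₁ a - w a) = r a ∧ zNorm (q₁ a - w a) = R a ∧ zNorm (p₂ a - w a) = r a ∧
        zNorm (q₂ a - w a) = R a ∧ PathIn (openGraph ω) (NeckCoarseZ2.zAnn (w a) (r a) (R a)) (p₁ a) (q₁ a) ∧
        PathIn (openGraph ω) (NeckCoarseZ2.zAnn (w a) (r a) (R a)) (p₂ a) (q₂ a) ∧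
        ¬ PathIn (openGraph ω) (NeckCoarseZ2.zAnn (w a) (r a) (R a)) (p₁ a) (p₂ a)) ∧
      (∀ i ∈ u, zNorm (c i - w' i) < r' i ∧ ∃ q, (R' i : ℤ) ≤ zNorm (q - w' i) ∧
        PathIn (openGraph ω) S (c i) q) ∧
      (∀ i ∈ u, ∀ j ∈ u, i ≠ j → ¬ PathIn (openGraph ω) S (c i) (c j) ∨
        Disjoint (NeckCoarseZ2.zAnn (w' i) (r' i) (R' i)) (NeckCoarseZ2.zAnn (w' j) (r' j) (R' j))) ∧
      (∀ i ∈ u, ∀ a ∈ t, (¬ PathIn (openGraph ω) S (c i) (p₁ a) ∧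
        ¬ PathIn (openGraph ω) S (c i) (p₂ a)) ∨
        Disjoint (NeckCoarseZ2.zAnn (w' i) (r' i) (R' i)) (NeckCoarseZ2.zAnn (w a) (r a) (R a)))} := ⟨_, rfl⟩
  rw [← hE]
  set μ := bondPercolation (zdGraph 2) half with hμ
  set L := u.toList.map fun i ↦ NeckCoarseZ2.zOneArmAt (w' i) (r' i) (R' i) with hL
  set A := ⋂ a ∈ t, fourArmTwoClustersAt (w a) (r a) (R a) with hA
  -- off a null set, the event implies the disjoint occurrence of `A` and the arm events
  have hcover : E ∩ {ω | ω ⊆ (zdGraph 2).edgeSet} ⊆ A □ disjointOccurrenceList L := by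
    rintro ω ⟨hω, hlat⟩
    rw [hE] at hω
    obtain ⟨p₁, q₁, p₂, q₂, cc, h4a, harm, hdist, havoid⟩ := hω
    have hHG : ∀ a b, (openGraph ω).Adj a b → (zdGraph 2).Adj a b := fun a b h ↦
      (SimpleGraph.mem_edgeSet _).1 (hlat ((openGraph_adj ω a b).1 h).1)
    exact NeckCoarseZ2.mem_fourArm_disjointOccurrence_armsIn hHG S t w r R hrR hS u.toList (Finset.nodup_toList u)
      w' r' R' (fun i hi ↦ by have := (hrR' i (Finset.mem_toList.1 hi)).2; omega) p₁ q₁ p₂ q₂ cc h4a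
      (fun i hi ↦ harm i (Finset.mem_toList.1 hi))
      (fun i hi j hj hij ↦ hdist i (Finset.mem_toList.1 hi) j (Finset.mem_toList.1 hj) hij)
      fun i hi a ha ↦ havoid i (Finset.mem_toList.1 hi) a ha
  have hae : ∀ᵐ ω ∂μ, ω ⊆ (zdGraph 2).edgeSet := ae_subset_edgeSet (zdGraph 2) half
  have heq : μ.real E = μ.real (E ∩ {ω | ω ⊆ (zdGraph 2).edgeSet}) := by
    refine measureReal_congr (Filter.eventuallyEq_set.2 (hae.mono fun ω hω ↦ ?_))
    simp only [mem_inter_iff, mem_setOf_eq, hω, and_true]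
  have hup : ∀ D ∈ L, IsUpperSet D := fun D hD ↦ by
    obtain ⟨i, -, rfl⟩ := List.mem_map.1 hD
    exact NeckCoarseZ2.isUpperSet_zOneArmAt _ _ _
  have hfin : ∀ D ∈ L, IsFinitary D := fun D hD ↦ by
    obtain ⟨i, -, rfl⟩ := List.mem_map.1 hD
    exact NeckCoarseZ2.isFinitary_zOneArmAt _ _ _
  have hAloc : IsLocalEvent A := NeckCoarseZ2.isLocalEvent_biInter_fourArm t w r R fun a ha ↦ (hrR a ha).1
  have hreimer : μ.real (A □ disjointOccurrenceList L) ≤ μ.real A * (L.map μ.real).prod := by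
    have h := reimer_local_finitary_list (zdGraph 2) half hAloc isUpperSet_univ isFinitary_univ L hup hfin
    rwa [inter_univ] at h
  have hprod : (L.map μ.real).prod = ∏ i ∈ u, μ.real (NeckCoarseZ2.zOneArmAt (w' i) (r' i) (R' i)) := by
    rw [hL, List.map_map, Function.comp_def, Finset.prod_map_toList]
  have hA4 : μ.real A ≤ ∏ a ∈ t, c * ((r a : ℝ) / R a) ^ (1 + ε) := h4 ι t w r R hrR hdisj
  calc μ.real E = μ.real (E ∩ {ω | ω ⊆ (zdGraph 2).edgeSet}) := heq
    _ ≤ μ.real (A □ disjointOccurrenceList L) := measureReal_mono hcover (measure_ne_top _ _)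
    _ ≤ μ.real A * (L.map μ.real).prod := hreimer
    _ = μ.real A * ∏ i ∈ u, μ.real (NeckCoarseZ2.zOneArmAt (w' i) (r' i) (R' i)) := by rw [hprod]
    _ ≤ (∏ a ∈ t, c * ((r a : ℝ) / R a) ^ (1 + ε)) * ∏ i ∈ u, C * ((r' i : ℝ) / ((R' i - 1 : ℕ) : ℝ)) ^ α :=
        mul_le_mul hA4 (Finset.prod_le_prod (fun i _ ↦ measureReal_nonneg)
          fun i hi ↦ h1 (w' i) (r' i) (R' i) (hrR' i hi).1 (hrR' i hi).2)
          (Finset.prod_nonneg fun i _ ↦ measureReal_nonneg) (le_trans measureReal_nonneg hA4)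

end Summit.CriticalPhenomena.CardyFormulaZ2.Cruxes.NestingRigidity.PinchResampling

end
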